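import Mathlib
import HarnessLib

/-!
# Route `UnitScaleTilt`, crux K1 «MinimiserStabilityRegPr» (stmt-QuantumFields-19200) — route-R E′ (A′), LANE II «DIVERGENCE RECOVERY AT CURVED `W`» (★★OWNER RULING №23),
# brick (B2a-F1′) «NORM-TRANSFER ROWS OF THE FIBREWISE-CORRECTED SECTION» — generic `Finset`∕normed-group algebra (no lattice):
# **for `J u := I u + J₀ (N ((1 − Q′∘I) u))` with a FIBREWISE correction `N` (`‖(N v) y‖ ≤ κ‖v y‖`), the gradient row and the size row of `J` follow from those of `I`, `J₀`
# and the defect row of `I`, with the displayed constants `2a₁ + 2bκ²g₁`, `2a₂ + 2bκ²g₂`** (★p1 g19 LANE II NAMER WORD №6 (1), 2026-08-29: F1 ↦ F1′; the EXACTNESS half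
# `Q′ ∘ J = id` is ✓p704472 `Prop7QprimeCombBumpSection.exists_exact_of_fibrewise_near_id`, NOT restated here).

Cell `ym3-torus` ∕ width seat `ym3-torus-px9` (gen 7, «width 9»).  THEOREMS ONLY (0 `def`, 0 `sorry`); `--supports stmt-QuantumFields-19200 --as helper`, count-neutral.
YM₃ on T³ is a ladder rung (R3), not d = 4, not the Clay problem; nothing here claims (B2a), the divergence-recovery row (REC), `hN06`, E′, EX or the gap.

WHY.  Brick (B2a) of LANE II builds the smooth exact right inverse of the comb average `Q′_W = QprimeCombL2 W` as `J := I_σ + J⁰_σ ∘ N ∘ (1 − Q′∘I_σ)`: `I_σ` a tent quasi-interpolant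
(F4: gradient row against the coarse covariant gradient currency `G`, defect row for `(1 − Q′∘I_σ)`), `J⁰_σ` a block-bump section (F2∕F2b: gradient and size rows against the coarse mass
currency `M u = c₀ℓ³·Σ_y‖u y‖²`), `N = (1 + E)⁻¹` the fibrewise correction of ✓p704472 §4 (`(N u) y = N_y (u y)`, `‖N_y m‖ ≤ (1 − θ)⁻¹‖m‖`).  The assembly (★p1 g19's F5) needs the two
rows of `J` in the SAME currencies; this file is that bookkeeping, once, generically: the only property of the mass currency used is `M (N v) ≤ k·M v` (here `k = κ²`, from the fibre
bound), so §2 is stated for ARBITRARY functionals `G, M : (ι → V) → ℝ` and §3 instantiates `M u := c·Σ_y‖u y‖²`.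

WHAT IS PROVED (ns `…Theorems.Prop7FibrewiseSectionRows`; `𝕜` any field; `V`, `E` normed additive groups with `𝕜`-module structures; `S` any `𝕜`-module (normed in the size rows);
`ι` any index type, finite where `Σ_y` is over all sites; `C := ι → V`):
* §1 NORM TRANSFER: `fibre_bound_of_fibrewise` (✓p704472 §4's `(N u) y = Ny y (u y)`, `‖Ny y m‖ ≤ κ‖m‖` ⇒ `‖(N v) y‖ ≤ κ‖v y‖`), ★ `sum_norm_sq_le_of_fibre_bound`
  (`Σ_{y∈s}‖(N v) y‖² ≤ κ²·Σ_{y∈s}‖v y‖²`, any `Finset`), `sum_norm_sq_le_of_fibre_bound_univ`, ★ `mul_sum_norm_sq_le_of_fibre_bound` (the weighted currency `c·Σ`, `0 ≤ c`),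
  `inv_one_sub_sq_le_four` (`θ ≤ ½ ⇒ ((1−θ)⁻¹)² ≤ 4`).
* §2 ASSEMBLY, abstract currencies: ★★ `normSq_apply_correction_le` — `D : S →ₗ E`; from `‖D(I u)‖² ≤ a₁·G u + a₂·M u`, `‖D(J₀ v)‖² ≤ b·M v` (`0 ≤ b`), `M (N v) ≤ k·M v` (`0 ≤ k`),
  `M ((1 − Q′∘I) u) ≤ g₁·G u + g₂·M u` ⊢ `‖D ((I + J₀∘N∘(1 − Q′∘I)) u)‖² ≤ 2a₁·G u + 2a₂·M u + 2bk·(g₁·G u + g₂·M u)`; `normSq_apply_correction_le'` (constants collected: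
  `(2a₁ + 2bk g₁)·G u + (2a₂ + 2bk g₂)·M u`); ★ `normSq_correction_le` ∕ `normSq_correction_le'` — the SIZE rows (`S` normed, `D := id`: `‖(I + J₀∘N∘(1 − Q′∘I)) u‖² ≤ …`).
* §3 ASSEMBLY in ★p1 g19's letters (`M u := c·Σ_y‖u y‖²`, `k := κ²`, `κ := (1−θ)⁻¹` at the member): ★★★ `gradRow_correction_of_fibre_bound` and ★★ `sizeRow_correction_of_fibre_bound`
  (+ the primed collected-constant forms) — `exact`-able on the witness `N` of ✓`exists_exact_of_fibrewise_near_id`.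
HONEST SCOPE.  `Finset` sums and the triangle inequality; nothing of the lattice, of print, of (B2a) ∕ (REC) ∕ `hN06` ∕ the crux is asserted; rung R3, not Clay; YM gap NOT proved.

References: T. Bałaban, CMP 99 (1985) 389–434 [Balaban1985BackgroundPropagators] ((3.17)–(3.21) pp.393–394: the averaging `Q′`, its sections and the `H¹`-type rows of the
minimisers); T. Bałaban, CMP 98 (1985) 17–51 [Balaban1985Averaging] ((78)–(80) p.30); [folklore] (`‖x + y‖² ≤ 2‖x‖² + 2‖y‖²`).
-/

set_option autoImplicit false

namespace Summit.QuantumFields.YangMills.Theorems.Prop7FibrewiseSectionRows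

/-! ## §1 Norm transfer: a fibre bound sums to an `ℓ²` bound over the sites -/

section Transfer

variable {𝕜 : Type*} [Field 𝕜] {V : Type*} [NormedAddCommGroup V] [Module 𝕜 V] {ι : Type*}

/-- ✓p704472 §4's presentation of the fibrewise correction (`(N u) y = Ny y (u y)` with the fibre bound `‖Ny y m‖ ≤ κ‖m‖`) gives the pointwise bound `‖(N v) y‖ ≤ κ‖v y‖`
this file consumes. -/
theorem fibre_bound_of_fibrewise {κ : ℝ} (N : (ι → V) →ₗ[𝕜] (ι → V)) (Ny : ι → V →ₗ[𝕜] V)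
    (hfib : ∀ (u : ι → V) (y : ι), N u y = Ny y (u y)) (hNy : ∀ (y : ι) (m : V), ‖Ny y m‖ ≤ κ * ‖m‖) :
    ∀ (v : ι → V) (y : ι), ‖N v y‖ ≤ κ * ‖v y‖ := fun v y => by
  rw [hfib]
  exact hNy y (v y)

/-- ★ NORM TRANSFER over any finite set of sites: `‖(N v) y‖ ≤ κ‖v y‖` for all `v, y` gives `Σ_{y∈s}‖(N v) y‖² ≤ κ²·Σ_{y∈s}‖v y‖²`
(no sign hypothesis on `κ`: `0 ≤ ‖(N v) y‖ ≤ κ‖v y‖` is squared termwise). -/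
theorem sum_norm_sq_le_of_fibre_bound {κ : ℝ} (N : (ι → V) →ₗ[𝕜] (ι → V)) (hN : ∀ (v : ι → V) (y : ι), ‖N v y‖ ≤ κ * ‖v y‖)
    (s : Finset ι) (v : ι → V) : ∑ y ∈ s, ‖N v y‖ ^ 2 ≤ κ ^ 2 * ∑ y ∈ s, ‖v y‖ ^ 2 := by
  rw [Finset.mul_sum]
  refine Finset.sum_le_sum fun y _ => ?_
  calc ‖N v y‖ ^ 2 ≤ (κ * ‖v y‖) ^ 2 := pow_le_pow_left₀ (norm_nonneg _) (hN v y) 2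
    _ = κ ^ 2 * ‖v y‖ ^ 2 := by ring

/-- NORM TRANSFER over all sites (`ι` finite). -/
theorem sum_norm_sq_le_of_fibre_bound_univ [Fintype ι] {κ : ℝ} (N : (ι → V) →ₗ[𝕜] (ι → V))
    (hN : ∀ (v : ι → V) (y : ι), ‖N v y‖ ≤ κ * ‖v y‖) (v : ι → V) :
    ∑ y, ‖N v y‖ ^ 2 ≤ κ ^ 2 * ∑ y, ‖v y‖ ^ 2 :=
  sum_norm_sq_le_of_fibre_bound N hN Finset.univ v

/-- ★ NORM TRANSFER in the weighted coarse currency `c·Σ_y‖· y‖²` (`0 ≤ c`; at the member `c = c₀·ℓ³`): `c·Σ‖(N v) y‖² ≤ κ²·(c·Σ‖v y‖²)`. -/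
theorem mul_sum_norm_sq_le_of_fibre_bound [Fintype ι] {κ c : ℝ} (hc : 0 ≤ c) (N : (ι → V) →ₗ[𝕜] (ι → V))
    (hN : ∀ (v : ι → V) (y : ι), ‖N v y‖ ≤ κ * ‖v y‖) (v : ι → V) :
    c * ∑ y, ‖N v y‖ ^ 2 ≤ κ ^ 2 * (c * ∑ y, ‖v y‖ ^ 2) := by
  calc c * ∑ y, ‖N v y‖ ^ 2 ≤ c * (κ ^ 2 * ∑ y, ‖v y‖ ^ 2) := mul_le_mul_of_nonneg_left (sum_norm_sq_le_of_fibre_bound_univ N hN v) hc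
    _ = κ ^ 2 * (c * ∑ y, ‖v y‖ ^ 2) := by ring

/-- Numeral: `θ ≤ ½ ⇒ ((1 − θ)⁻¹)² ≤ 4` (the member's `κ = (1 − θ)⁻¹`, ✓p704472 §4). -/
theorem inv_one_sub_sq_le_four {θ : ℝ} (hθ : θ ≤ 1 / 2) : ((1 - θ)⁻¹) ^ 2 ≤ 4 := by
  have hpos : 0 < 1 - θ := by linarith
  have h1 : (1 - θ)⁻¹ ≤ 2 :=
    calc (1 - θ)⁻¹ ≤ (1 / 2 : ℝ)⁻¹ := inv_anti₀ (by norm_num) (by linarith)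
      _ = 2 := by norm_num
  have h0 : 0 ≤ (1 - θ)⁻¹ := inv_nonneg.mpr hpos.le
  nlinarith

end Transfer

/-! ## §2 Assembly of the rows of `J := I + J₀ ∘ N ∘ (1 − Q′∘I)` in abstract currencies `G`, `M` -/

section Assembly

variable {𝕜 : Type*} [Field 𝕜] {V : Type*} [AddCommGroup V] [Module 𝕜 V] {ι : Type*}
  {S : Type*} [AddCommGroup S] [Module 𝕜 S] {E : Type*} [NormedAddCommGroup E] [Module 𝕜 E]

/-- The corrected section unfolded: `(I + J₀ ∘ N ∘ (1 − Q′∘I)) u = I u + J₀ (N (u − Q′ (I u)))`. -/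
theorem correction_apply (Q' : S →ₗ[𝕜] (ι → V)) (J₀ I : (ι → V) →ₗ[𝕜] S) (N : (ι → V) →ₗ[𝕜] (ι → V)) (u : ι → V) :
    (I + J₀ ∘ₗ N ∘ₗ (LinearMap.id - Q' ∘ₗ I) : (ι → V) →ₗ[𝕜] S) u = I u + J₀ (N (u - Q' (I u))) := by
  simp only [LinearMap.add_apply, LinearMap.comp_apply, LinearMap.sub_apply, LinearMap.id_apply]

/-- ★★ **GRADIENT-TYPE ROW OF THE CORRECTED SECTION, abstract currencies.**  `D : S →ₗ E` any linear map into a normed group (at the member `D = DL2 W`, the covariant gradient);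
`G, M : (ι → V) → ℝ` any functionals (coarse gradient and mass currencies).  From the rows of `I` (`‖D(I u)‖² ≤ a₁G u + a₂M u`), of `J₀` (`‖D(J₀ v)‖² ≤ b·M v`, `0 ≤ b`),
the transfer of `M` through `N` (`M (N v) ≤ k·M v`, `0 ≤ k`) and the defect row of `I` (`M (u − Q′(I u)) ≤ g₁G u + g₂M u`):
`‖D ((I + J₀∘N∘(1 − Q′∘I)) u)‖² ≤ 2a₁·G u + 2a₂·M u + 2bk·(g₁·G u + g₂·M u)`. [folklore] -/
theorem normSq_apply_correction_le (Q' : S →ₗ[𝕜] (ι → V)) (J₀ I : (ι → V) →ₗ[𝕜] S) (N : (ι → V) →ₗ[𝕜] (ι → V)) (D : S →ₗ[𝕜] E)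
    (G M : (ι → V) → ℝ) {a₁ a₂ b k g₁ g₂ : ℝ} (hb : 0 ≤ b) (hk : 0 ≤ k)
    (hI : ∀ u, ‖D (I u)‖ ^ 2 ≤ a₁ * G u + a₂ * M u) (hJ₀ : ∀ v, ‖D (J₀ v)‖ ^ 2 ≤ b * M v)
    (hN : ∀ v, M (N v) ≤ k * M v) (hdef : ∀ u, M (u - Q' (I u)) ≤ g₁ * G u + g₂ * M u) (u : ι → V) :
    ‖D ((I + J₀ ∘ₗ N ∘ₗ (LinearMap.id - Q' ∘ₗ I) : (ι → V) →ₗ[𝕜] S) u)‖ ^ 2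
      ≤ 2 * a₁ * G u + 2 * a₂ * M u + 2 * b * k * (g₁ * G u + g₂ * M u) := by
  rw [correction_apply, map_add]
  set x := D (I u) with hx
  set y := D (J₀ (N (u - Q' (I u)))) with hy
  have htri : ‖x + y‖ ≤ ‖x‖ + ‖y‖ := norm_add_le x y
  have hsq : ‖x + y‖ ^ 2 ≤ 2 * ‖x‖ ^ 2 + 2 * ‖y‖ ^ 2 := by
    nlinarith [htri, norm_nonneg (x + y), norm_nonneg x, norm_nonneg y, sq_nonneg (‖x‖ - ‖y‖)]
  have h1 : ‖x‖ ^ 2 ≤ a₁ * G u + a₂ * M u := hI u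
  have h2 : ‖y‖ ^ 2 ≤ b * k * (g₁ * G u + g₂ * M u) := by
    calc ‖y‖ ^ 2 ≤ b * M (N (u - Q' (I u))) := hJ₀ _
      _ ≤ b * (k * M (u - Q' (I u))) := mul_le_mul_of_nonneg_left (hN _) hb
      _ ≤ b * (k * (g₁ * G u + g₂ * M u)) := mul_le_mul_of_nonneg_left (mul_le_mul_of_nonneg_left (hdef u) hk) hb
      _ = b * k * (g₁ * G u + g₂ * M u) := by ring
  nlinarith [hsq, h1, h2]

/-- The same row with the constants collected per currency: `≤ (2a₁ + 2bk·g₁)·G u + (2a₂ + 2bk·g₂)·M u`. -/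
theorem normSq_apply_correction_le' (Q' : S →ₗ[𝕜] (ι → V)) (J₀ I : (ι → V) →ₗ[𝕜] S) (N : (ι → V) →ₗ[𝕜] (ι → V)) (D : S →ₗ[𝕜] E)
    (G M : (ι → V) → ℝ) {a₁ a₂ b k g₁ g₂ : ℝ} (hb : 0 ≤ b) (hk : 0 ≤ k)
    (hI : ∀ u, ‖D (I u)‖ ^ 2 ≤ a₁ * G u + a₂ * M u) (hJ₀ : ∀ v, ‖D (J₀ v)‖ ^ 2 ≤ b * M v)
    (hN : ∀ v, M (N v) ≤ k * M v) (hdef : ∀ u, M (u - Q' (I u)) ≤ g₁ * G u + g₂ * M u) (u : ι → V) :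
    ‖D ((I + J₀ ∘ₗ N ∘ₗ (LinearMap.id - Q' ∘ₗ I) : (ι → V) →ₗ[𝕜] S) u)‖ ^ 2
      ≤ (2 * a₁ + 2 * b * k * g₁) * G u + (2 * a₂ + 2 * b * k * g₂) * M u := by
  have h := normSq_apply_correction_le Q' J₀ I N D G M hb hk hI hJ₀ hN hdef u
  linarith

end Assembly

section Size

variable {𝕜 : Type*} [Field 𝕜] {V : Type*} [AddCommGroup V] [Module 𝕜 V] {ι : Type*}
  {S : Type*} [NormedAddCommGroup S] [Module 𝕜 S]

/-- ★ **SIZE ROW OF THE CORRECTED SECTION, abstract currencies** (`S` normed): from `‖I u‖² ≤ a₁G u + a₂M u`, `‖J₀ v‖² ≤ b·M v` (`0 ≤ b`), `M (N v) ≤ k·M v` (`0 ≤ k`),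
`M (u − Q′(I u)) ≤ g₁G u + g₂M u`: `‖(I + J₀∘N∘(1 − Q′∘I)) u‖² ≤ 2a₁·G u + 2a₂·M u + 2bk·(g₁·G u + g₂·M u)`. [folklore] -/
theorem normSq_correction_le (Q' : S →ₗ[𝕜] (ι → V)) (J₀ I : (ι → V) →ₗ[𝕜] S) (N : (ι → V) →ₗ[𝕜] (ι → V))
    (G M : (ι → V) → ℝ) {a₁ a₂ b k g₁ g₂ : ℝ} (hb : 0 ≤ b) (hk : 0 ≤ k)
    (hI : ∀ u, ‖I u‖ ^ 2 ≤ a₁ * G u + a₂ * M u) (hJ₀ : ∀ v, ‖J₀ v‖ ^ 2 ≤ b * M v)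
    (hN : ∀ v, M (N v) ≤ k * M v) (hdef : ∀ u, M (u - Q' (I u)) ≤ g₁ * G u + g₂ * M u) (u : ι → V) :
    ‖(I + J₀ ∘ₗ N ∘ₗ (LinearMap.id - Q' ∘ₗ I) : (ι → V) →ₗ[𝕜] S) u‖ ^ 2
      ≤ 2 * a₁ * G u + 2 * a₂ * M u + 2 * b * k * (g₁ * G u + g₂ * M u) := by
  have h := normSq_apply_correction_le Q' J₀ I N (LinearMap.id : S →ₗ[𝕜] S) G M hb hk
    (fun u => by simpa only [LinearMap.id_apply] using hI u) (fun v => by simpa only [LinearMap.id_apply] using hJ₀ v) hN hdef u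
  simpa only [LinearMap.id_apply] using h

/-- The size row with the constants collected per currency. -/
theorem normSq_correction_le' (Q' : S →ₗ[𝕜] (ι → V)) (J₀ I : (ι → V) →ₗ[𝕜] S) (N : (ι → V) →ₗ[𝕜] (ι → V))
    (G M : (ι → V) → ℝ) {a₁ a₂ b k g₁ g₂ : ℝ} (hb : 0 ≤ b) (hk : 0 ≤ k)
    (hI : ∀ u, ‖I u‖ ^ 2 ≤ a₁ * G u + a₂ * M u) (hJ₀ : ∀ v, ‖J₀ v‖ ^ 2 ≤ b * M v)
    (hN : ∀ v, M (N v) ≤ k * M v) (hdef : ∀ u, M (u - Q' (I u)) ≤ g₁ * G u + g₂ * M u) (u : ι → V) :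
    ‖(I + J₀ ∘ₗ N ∘ₗ (LinearMap.id - Q' ∘ₗ I) : (ι → V) →ₗ[𝕜] S) u‖ ^ 2
      ≤ (2 * a₁ + 2 * b * k * g₁) * G u + (2 * a₂ + 2 * b * k * g₂) * M u := by
  have h := normSq_correction_le Q' J₀ I N G M hb hk hI hJ₀ hN hdef u
  linarith

end Size

/-! ## §3 The rows in the lane's letters: mass currency `M u := c·Σ_y‖u y‖²`, fibre bound `‖(N v) y‖ ≤ κ‖v y‖` -/

section Letters

variable {𝕜 : Type*} [Field 𝕜] {V : Type*} [NormedAddCommGroup V] [Module 𝕜 V] {ι : Type*} [Fintype ι]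
  {S : Type*} [AddCommGroup S] [Module 𝕜 S] {E : Type*} [NormedAddCommGroup E] [Module 𝕜 E]

/-- ★★★ **(B2a-F1′) GRADIENT ROW OF `J := I + J₀ ∘ N ∘ (1 − Q′∘I)`.**  `D : S →ₗ E` linear into a normed group; `G : (ι → V) → ℝ` any functional (coarse gradient currency);
mass currency `c·Σ_y‖u y‖²`, `0 ≤ c`; fibrewise correction `N` with `‖(N v) y‖ ≤ κ‖v y‖` (✓p704472 §4: `κ = (1 − θ)⁻¹`, via `fibre_bound_of_fibrewise`).  From
`‖D(I u)‖² ≤ a₁·G u + a₂·(cΣ‖u y‖²)`, `‖D(J₀ v)‖² ≤ b·(cΣ‖v y‖²)` (`0 ≤ b`), `cΣ_y‖u y − Q′(I u) y‖² ≤ g₁·G u + g₂·(cΣ‖u y‖²)`: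
`‖D((I + J₀∘N∘(1 − Q′∘I)) u)‖² ≤ 2a₁·G u + 2a₂·(cΣ‖u y‖²) + 2bκ²·(g₁·G u + g₂·(cΣ‖u y‖²))`. [folklore] -/
theorem gradRow_correction_of_fibre_bound (Q' : S →ₗ[𝕜] (ι → V)) (J₀ I : (ι → V) →ₗ[𝕜] S) (N : (ι → V) →ₗ[𝕜] (ι → V)) (D : S →ₗ[𝕜] E)
    (G : (ι → V) → ℝ) {c κ a₁ a₂ b g₁ g₂ : ℝ} (hc : 0 ≤ c) (hb : 0 ≤ b)
    (hN : ∀ (v : ι → V) (y : ι), ‖N v y‖ ≤ κ * ‖v y‖)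
    (hI : ∀ u, ‖D (I u)‖ ^ 2 ≤ a₁ * G u + a₂ * (c * ∑ y, ‖u y‖ ^ 2))
    (hJ₀ : ∀ v, ‖D (J₀ v)‖ ^ 2 ≤ b * (c * ∑ y, ‖v y‖ ^ 2))
    (hdef : ∀ u, c * ∑ y, ‖u y - Q' (I u) y‖ ^ 2 ≤ g₁ * G u + g₂ * (c * ∑ y, ‖u y‖ ^ 2)) (u : ι → V) :
    ‖D ((I + J₀ ∘ₗ N ∘ₗ (LinearMap.id - Q' ∘ₗ I) : (ι → V) →ₗ[𝕜] S) u)‖ ^ 2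
      ≤ 2 * a₁ * G u + 2 * a₂ * (c * ∑ y, ‖u y‖ ^ 2) + 2 * b * κ ^ 2 * (g₁ * G u + g₂ * (c * ∑ y, ‖u y‖ ^ 2)) :=
  normSq_apply_correction_le Q' J₀ I N D G (fun u => c * ∑ y, ‖u y‖ ^ 2) hb (sq_nonneg κ) hI hJ₀
    (fun v => mul_sum_norm_sq_le_of_fibre_bound hc N hN v) (fun u => by simpa only [Pi.sub_apply] using hdef u) u

/-- ★★ The gradient row with the constants collected per currency: `≤ (2a₁ + 2bκ²g₁)·G u + (2a₂ + 2bκ²g₂)·(cΣ‖u y‖²)`. -/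
theorem gradRow_correction_of_fibre_bound' (Q' : S →ₗ[𝕜] (ι → V)) (J₀ I : (ι → V) →ₗ[𝕜] S) (N : (ι → V) →ₗ[𝕜] (ι → V)) (D : S →ₗ[𝕜] E)
    (G : (ι → V) → ℝ) {c κ a₁ a₂ b g₁ g₂ : ℝ} (hc : 0 ≤ c) (hb : 0 ≤ b)
    (hN : ∀ (v : ι → V) (y : ι), ‖N v y‖ ≤ κ * ‖v y‖)
    (hI : ∀ u, ‖D (I u)‖ ^ 2 ≤ a₁ * G u + a₂ * (c * ∑ y, ‖u y‖ ^ 2))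
    (hJ₀ : ∀ v, ‖D (J₀ v)‖ ^ 2 ≤ b * (c * ∑ y, ‖v y‖ ^ 2))
    (hdef : ∀ u, c * ∑ y, ‖u y - Q' (I u) y‖ ^ 2 ≤ g₁ * G u + g₂ * (c * ∑ y, ‖u y‖ ^ 2)) (u : ι → V) :
    ‖D ((I + J₀ ∘ₗ N ∘ₗ (LinearMap.id - Q' ∘ₗ I) : (ι → V) →ₗ[𝕜] S) u)‖ ^ 2
      ≤ (2 * a₁ + 2 * b * κ ^ 2 * g₁) * G u + (2 * a₂ + 2 * b * κ ^ 2 * g₂) * (c * ∑ y, ‖u y‖ ^ 2) := by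
  have h := gradRow_correction_of_fibre_bound Q' J₀ I N D G hc hb hN hI hJ₀ hdef u
  linarith

end Letters

section LettersSize

variable {𝕜 : Type*} [Field 𝕜] {V : Type*} [NormedAddCommGroup V] [Module 𝕜 V] {ι : Type*} [Fintype ι]
  {S : Type*} [NormedAddCommGroup S] [Module 𝕜 S]

/-- ★★ **(B2a-F1′) SIZE ROW OF `J := I + J₀ ∘ N ∘ (1 − Q′∘I)`** (`S` normed): from `‖I u‖² ≤ a₁·G u + a₂·(cΣ‖u y‖²)`, `‖J₀ v‖² ≤ b·(cΣ‖v y‖²)` (`0 ≤ b`), the fibre bound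
`‖(N v) y‖ ≤ κ‖v y‖` and the defect row `cΣ_y‖u y − Q′(I u) y‖² ≤ g₁·G u + g₂·(cΣ‖u y‖²)` (`0 ≤ c`):
`‖(I + J₀∘N∘(1 − Q′∘I)) u‖² ≤ 2a₁·G u + 2a₂·(cΣ‖u y‖²) + 2bκ²·(g₁·G u + g₂·(cΣ‖u y‖²))`. [folklore] -/
theorem sizeRow_correction_of_fibre_bound (Q' : S →ₗ[𝕜] (ι → V)) (J₀ I : (ι → V) →ₗ[𝕜] S) (N : (ι → V) →ₗ[𝕜] (ι → V))
    (G : (ι → V) → ℝ) {c κ a₁ a₂ b g₁ g₂ : ℝ} (hc : 0 ≤ c) (hb : 0 ≤ b)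
    (hN : ∀ (v : ι → V) (y : ι), ‖N v y‖ ≤ κ * ‖v y‖)
    (hI : ∀ u, ‖I u‖ ^ 2 ≤ a₁ * G u + a₂ * (c * ∑ y, ‖u y‖ ^ 2))
    (hJ₀ : ∀ v, ‖J₀ v‖ ^ 2 ≤ b * (c * ∑ y, ‖v y‖ ^ 2))
    (hdef : ∀ u, c * ∑ y, ‖u y - Q' (I u) y‖ ^ 2 ≤ g₁ * G u + g₂ * (c * ∑ y, ‖u y‖ ^ 2)) (u : ι → V) :
    ‖(I + J₀ ∘ₗ N ∘ₗ (LinearMap.id - Q' ∘ₗ I) : (ι → V) →ₗ[𝕜] S) u‖ ^ 2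
      ≤ 2 * a₁ * G u + 2 * a₂ * (c * ∑ y, ‖u y‖ ^ 2) + 2 * b * κ ^ 2 * (g₁ * G u + g₂ * (c * ∑ y, ‖u y‖ ^ 2)) :=
  normSq_correction_le Q' J₀ I N G (fun u => c * ∑ y, ‖u y‖ ^ 2) hb (sq_nonneg κ) hI hJ₀
    (fun v => mul_sum_norm_sq_le_of_fibre_bound hc N hN v) (fun u => by simpa only [Pi.sub_apply] using hdef u) u

/-- The size row with the constants collected per currency; with `a₁ = g₁… ` free, the pure-mass special case is `G := 0`-free to the consumer (take `a₁ = g₁ = 0`). -/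
theorem sizeRow_correction_of_fibre_bound' (Q' : S →ₗ[𝕜] (ι → V)) (J₀ I : (ι → V) →ₗ[𝕜] S) (N : (ι → V) →ₗ[𝕜] (ι → V))
    (G : (ι → V) → ℝ) {c κ a₁ a₂ b g₁ g₂ : ℝ} (hc : 0 ≤ c) (hb : 0 ≤ b)
    (hN : ∀ (v : ι → V) (y : ι), ‖N v y‖ ≤ κ * ‖v y‖)
    (hI : ∀ u, ‖I u‖ ^ 2 ≤ a₁ * G u + a₂ * (c * ∑ y, ‖u y‖ ^ 2))
    (hJ₀ : ∀ v, ‖J₀ v‖ ^ 2 ≤ b * (c * ∑ y, ‖v y‖ ^ 2))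
    (hdef : ∀ u, c * ∑ y, ‖u y - Q' (I u) y‖ ^ 2 ≤ g₁ * G u + g₂ * (c * ∑ y, ‖u y‖ ^ 2)) (u : ι → V) :
    ‖(I + J₀ ∘ₗ N ∘ₗ (LinearMap.id - Q' ∘ₗ I) : (ι → V) →ₗ[𝕜] S) u‖ ^ 2
      ≤ (2 * a₁ + 2 * b * κ ^ 2 * g₁) * G u + (2 * a₂ + 2 * b * κ ^ 2 * g₂) * (c * ∑ y, ‖u y‖ ^ 2) := by
  have h := sizeRow_correction_of_fibre_bound Q' J₀ I N G hc hb hN hI hJ₀ hdef u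
  linarith

end LettersSize

end Summit.QuantumFields.YangMills.Theorems.Prop7FibrewiseSectionRows
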